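import Literature.NumberTheory.PAdicHodge.BmaxPlusKerTheta
import HarnessLib

/-!
# The exact Frobenius of `[p♭]/p ∈ A_max` and `φⁿ(A_max) ⊆ 𝔸_inf + p^{n(p−1)}·A_max`

Topic `Literature/NumberTheory/PAdicHodge`; namespace `Literature.NumberTheory.PAdicHodge`. THEOREMS ONLY (no definition, no named
fact, no instance). Continuation of `BmaxZero` / `BmaxPlus` / `BmaxPlusTheta` / `BmaxPlusKerTheta` on Colmez's `A_max = B_max⁺(F)`
(`p`-adic completion of `B⁰_max = 𝔸_inf[ξ/p]`, `ω = ξ/p = omegaB`, `φ = frobBmaxZero / frobBmaxPlus`):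

* `natCast_mul_omegaB_add_one`, ★ `frobBmaxZero_omegaB_add_one` — the element **`ω' = ξ/p + 1 = [p♭]/p`** generates `B⁰_max` over `𝔸_inf`
  as well and has the EXACT Frobenius **`φ(ω') = p^{p−1}·ω'^p`** (`[p♭]` is a Teichmüller representative), with `θ(ω') = 1`;
* ★ `exists_frobBmaxZero_eq_algebraMap_add_pow_mul` — **`φ(B⁰_max) ⊆ 𝔸_inf + p^{p−1}·B⁰_max`**, and by iteration
  ★ `exists_frobBmaxZero_iterate_eq_algebraMap_add_pow_mul` — **`φⁿ(B⁰_max) ⊆ 𝔸_inf + p^{n(p−1)}·B⁰_max`**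
  (`φⁿ(ω') = p^{pⁿ−1}ω'^{pⁿ}`: Frobenius is strongly contracting towards `𝔸_inf`);
* ★ `exists_evalₐ_frobBmaxPlus_iterate_eq_mk_algebraMap` — the same for `A_max` levelwise: `φⁿ(x) mod p^N` is the class of an element of
  `𝔸_inf` whenever `N ≤ n(p−1)`; hence for a `φ = p` EIGENVECTOR `x` (`φx = px`), ★ `exists_evalₐ_pow_mul_eq_mk_algebraMap_of_frobBmaxPlus_eq`:
  **`pⁿ·x ≡ ι(aₙ) (mod p^N A_max)` with `aₙ ∈ 𝔸_inf`** for all `N ≤ n(p−1)` — an eigenvector is the `p`-adic limit of `ι(aₙ)/pⁿ`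
  (for `p ≥ 3`), the "φ-regularisation" description of `(A_max)^{φ=p}` (e.g. `t = lim ([ε]^{pⁿ} − 1)/pⁿ`).

Brick B7 of the φ-road of line `kato_lever` (crux K★ `stmt-BirchSwinnertonDyer-22226`, memo
`Cruxes/StarredOptimalManinUnitFiveSeven/Lines/kato-lever-K2-fontaine-lemma.md` §1): structure used by the remaining `t`-divisibility
statement (TDIV). Infrastructure only: BSD / K★ are not proved by any of this.

## References
* [Colmez1998Annals] P. Colmez, *Théorie d'Iwasawa des représentations de de Rham d'un corps local*, Ann. of Math. 148 (1998), §III.2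
  (`A_max`, `φ(A_max)`).
* [BergerLaurent2002] L. Berger, *Représentations p-adiques et équations différentielles*, Invent. Math. 148 (2002), §1.2.
* [FontaineAsterisque223III] J.-M. Fontaine, *Le corps des périodes p-adiques*, Astérisque 223 (1994), Exp. II §2.3.
-/

noncomputable section

open WittVector Field ValuativeRel Polynomial Finset
open Literature.AlgebraicGeometry.Resolution

namespace Literature.NumberTheory.PAdicHodge

open Literature.NumberTheory.GaloisRepresentations
open Literature.NumberTheory.GaloisRepresentations.IsNonarchimedeanLocalField

variable {F : Type} [Field F] [ValuativeRel F] [TopologicalSpace F] [IsNonarchimedeanLocalField F]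
  [CharZero F] {p : ℕ} [Fact p.Prime] [Fact (¬ IsUnit (p : integerC F))]
  [IsAdicComplete (Ideal.span {(p : integerC F)}) (integerC F)]

/-! ### `ω' = ξ/p + 1 = [p♭]/p` and its exact Frobenius -/

omit [CharZero F] [IsAdicComplete (Ideal.span {(p : integerC F)}) (integerC F)] in
/-- **`p·(ξ/p + 1) = ξ + p = [p♭]`** in `B⁰_max`. [cite: BergerLaurent2002, §1.2] -/
theorem natCast_mul_omegaB_add_one :
    (p : bmaxZero F p) * (omegaB + 1) = algebraMap (Ainf (p := p) F) (bmaxZero F p) (teichmuller p pFlat) := by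
  rw [mul_add, natCast_mul_omegaB, mul_one, xi_def, map_sub, map_natCast, sub_add_cancel]

omit [CharZero F] [IsAdicComplete (Ideal.span {(p : integerC F)}) (integerC F)] in
/-- ★ **The exact Frobenius `φ(ξ/p + 1) = p^{p−1}·(ξ/p + 1)^p`**: `ξ/p + 1 = [p♭]/p` and `φ[p♭] = [p♭]^p`.
[cite: Colmez1998Annals, §III.2] -/
theorem frobBmaxZero_omegaB_add_one :
    frobBmaxZero F p (omegaB + 1) = (p : bmaxZero F p) ^ (p - 1) * (omegaB + 1) ^ p := by
  have hp1 : p - 1 + 1 = p := Nat.sub_add_cancel (Fact.out : p.Prime).one_le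
  refine eq_of_natCast_pow_mul_eq (p := p) (F := F) (v := 1) ?_
  have e1 : (p : bmaxZero F p) * frobBmaxZero F p (omegaB + 1) = frobBmaxZero F p ((p : bmaxZero F p) * (omegaB + 1)) := by
    rw [map_mul, frobBmaxZero_natCast]
  have e2 : frobBmaxZero F p ((p : bmaxZero F p) * (omegaB + 1)) =
      algebraMap (Ainf (p := p) F) (bmaxZero F p) (teichmuller p pFlat) ^ p := by
    rw [natCast_mul_omegaB_add_one, frobBmaxZero_algebraMap, frobenius_teichmuller, map_pow]
  rw [pow_one, e1, e2, ← natCast_mul_omegaB_add_one, mul_pow, ← mul_assoc, ← pow_succ', hp1]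

/-- **`θ(ξ/p + 1) = 1`.** [cite: Colmez1998Annals, §III.2] -/
theorem thetaBmaxZero_omegaB_add_one : thetaBmaxZero F p (omegaB + 1 : bmaxZero F p) = 1 := by
  rw [map_add, thetaBmaxZero_omegaB, zero_add, map_one]

/-! ### `φ(B⁰_max) ⊆ 𝔸_inf + p^{p−1}·B⁰_max` -/

omit [CharZero F] [IsAdicComplete (Ideal.span {(p : integerC F)}) (integerC F)] in
/-- ★ **`φ(y) ∈ 𝔸_inf + p^{p−1}·B⁰_max` for every `y ∈ B⁰_max`** (`φ(ξ/p) = p^{p−1}(ξ/p + 1)^p − 1`, and `𝔸_inf + p^{p−1}B⁰_max` is a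
subring). [cite: Colmez1998Annals, §III.2] -/
theorem exists_frobBmaxZero_eq_algebraMap_add_pow_mul (y : bmaxZero F p) :
    ∃ (b : Ainf (p := p) F) (z : bmaxZero F p),
      frobBmaxZero F p y = algebraMap (Ainf (p := p) F) (bmaxZero F p) b + (p : bmaxZero F p) ^ (p - 1) * z := by
  -- membership-free form, by induction over `𝔸_inf[ξ/p]`
  suffices h : ∀ x ∈ bmaxZero F p, ∃ (b : Ainf (p := p) F) (z : Localization.Away (p : Ainf (p := p) F)), z ∈ bmaxZero F p ∧
      frobAinfLoc F p x = algebraMap (Ainf (p := p) F) (Localization.Away (p : Ainf (p := p) F)) b +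
        algebraMap (Ainf (p := p) F) (Localization.Away (p : Ainf (p := p) F)) ((p : Ainf (p := p) F) ^ (p - 1)) * z by
    obtain ⟨b, z, hz, h⟩ := h y y.2
    refine ⟨b, ⟨z, hz⟩, Subtype.ext ?_⟩
    rw [coe_frobBmaxZero, h, Subalgebra.coe_add, Subalgebra.coe_mul, coe_algebraMap_bmaxZero, Subalgebra.coe_pow]
    congr 2
    rw [map_pow]
    congr 1
    rw [map_natCast]
    exact (map_natCast (bmaxZero F p).val p).symm
  intro x hx
  refine Algebra.adjoin_induction (fun w hw => ?_) (fun r => ?_) (fun w w' _ _ hw hw' => ?_) (fun w w' _ _ hw hw' => ?_) hx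
  · rw [Set.mem_singleton_iff.1 hw]
    obtain ⟨m, hm⟩ := exists_frobAinfLoc_xiDivP_eq (F := F) (p := p)
    exact ⟨m, xiDivP F p ^ p, pow_mem xiDivP_mem_bmaxZero p, by rw [hm, add_comm]⟩
  · exact ⟨WittVector.frobenius r, 0, zero_mem _, by rw [frobAinfLoc_algebraMap, mul_zero, add_zero]⟩
  · obtain ⟨b, z, hz, h⟩ := hw
    obtain ⟨b', z', hz', h'⟩ := hw'
    exact ⟨b + b', z + z', add_mem hz hz', by rw [map_add, h, h', map_add]; ring⟩
  · obtain ⟨b, z, hz, h⟩ := hw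
    obtain ⟨b', z', hz', h'⟩ := hw'
    refine ⟨b * b', z * algebraMap (Ainf (p := p) F) (Localization.Away (p : Ainf (p := p) F)) b' +
      algebraMap (Ainf (p := p) F) (Localization.Away (p : Ainf (p := p) F)) b * z' +
      algebraMap (Ainf (p := p) F) (Localization.Away (p : Ainf (p := p) F)) ((p : Ainf (p := p) F) ^ (p - 1)) * (z * z'), ?_, ?_⟩
    · exact add_mem (add_mem (mul_mem hz (algebraMap_mem_bmaxZero _)) (mul_mem (algebraMap_mem_bmaxZero _) hz'))
        (mul_mem (algebraMap_mem_bmaxZero _) (mul_mem hz hz'))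
    · rw [map_mul, h, h', map_mul]; ring

omit [CharZero F] [IsAdicComplete (Ideal.span {(p : integerC F)}) (integerC F)] in
set_option maxHeartbeats 800000 in
/-- ★ **`φⁿ(y) ∈ 𝔸_inf + p^{n(p−1)}·B⁰_max` for every `y ∈ B⁰_max`** (iterate, using `φ(𝔸_inf) ⊆ 𝔸_inf` and `φ(p) = p`): Frobenius contracts
`B⁰_max` towards `𝔸_inf`. [cite: Colmez1998Annals, §III.2] -/
theorem exists_frobBmaxZero_iterate_eq_algebraMap_add_pow_mul (n : ℕ) :
    ∀ y : bmaxZero F p, ∃ (b : Ainf (p := p) F) (z : bmaxZero F p),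
      (frobBmaxZero F p)^[n] y = algebraMap (Ainf (p := p) F) (bmaxZero F p) b + (p : bmaxZero F p) ^ (n * (p - 1)) * z := by
  induction n with
  | zero => intro y; exact ⟨0, y, by rw [Function.iterate_zero, id, map_zero, zero_add, zero_mul, pow_zero, one_mul]⟩
  | succ n ih =>
    intro y
    obtain ⟨b, z, h⟩ := ih y
    obtain ⟨b', z', h'⟩ := exists_frobBmaxZero_eq_algebraMap_add_pow_mul z
    refine ⟨WittVector.frobenius b + (p : Ainf (p := p) F) ^ (n * (p - 1)) * b', z', ?_⟩
    have e1 : (frobBmaxZero F p)^[n + 1] y = frobBmaxZero F p ((frobBmaxZero F p)^[n] y) := Function.iterate_succ_apply' _ _ _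
    have e2 : frobBmaxZero F p (algebraMap (Ainf (p := p) F) (bmaxZero F p) b + (p : bmaxZero F p) ^ (n * (p - 1)) * z) =
        algebraMap (Ainf (p := p) F) (bmaxZero F p) (WittVector.frobenius b) + (p : bmaxZero F p) ^ (n * (p - 1)) * frobBmaxZero F p z := by
      simp only [map_add, map_mul, map_pow, frobBmaxZero_algebraMap, frobBmaxZero_natCast]
    have e3 : algebraMap (Ainf (p := p) F) (bmaxZero F p) (WittVector.frobenius b + (p : Ainf (p := p) F) ^ (n * (p - 1)) * b') =
        algebraMap (Ainf (p := p) F) (bmaxZero F p) (WittVector.frobenius b) +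
          (p : bmaxZero F p) ^ (n * (p - 1)) * algebraMap (Ainf (p := p) F) (bmaxZero F p) b' := by
      simp only [map_add, map_mul, map_pow, map_natCast]
    calc (frobBmaxZero F p)^[n + 1] y
        = frobBmaxZero F p ((frobBmaxZero F p)^[n] y) := e1
      _ = frobBmaxZero F p (algebraMap (Ainf (p := p) F) (bmaxZero F p) b + (p : bmaxZero F p) ^ (n * (p - 1)) * z) := congrArg _ h
      _ = algebraMap (Ainf (p := p) F) (bmaxZero F p) (WittVector.frobenius b) + (p : bmaxZero F p) ^ (n * (p - 1)) * frobBmaxZero F p z := e2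
      _ = algebraMap (Ainf (p := p) F) (bmaxZero F p) (WittVector.frobenius b) + (p : bmaxZero F p) ^ (n * (p - 1)) *
            (algebraMap (Ainf (p := p) F) (bmaxZero F p) b' + (p : bmaxZero F p) ^ (p - 1) * z') :=
          congrArg (fun w => algebraMap (Ainf (p := p) F) (bmaxZero F p) (WittVector.frobenius b) + (p : bmaxZero F p) ^ (n * (p - 1)) * w) h'
      _ = algebraMap (Ainf (p := p) F) (bmaxZero F p) (WittVector.frobenius b + (p : Ainf (p := p) F) ^ (n * (p - 1)) * b') +
            (p : bmaxZero F p) ^ ((n + 1) * (p - 1)) * z' := by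
          rw [e3, add_mul, one_mul, pow_add]; ring

/-! ### `φⁿ(A_max) ⊆ 𝔸_inf + p^{n(p−1)}·A_max`, levelwise -/

set_option maxHeartbeats 1600000 in
omit [CharZero F] [IsAdicComplete (Ideal.span {(p : integerC F)}) (integerC F)] in
/-- `φⁿ(x) mod p^N = φⁿ(x_N) mod p^N` for a level-`N` representative `x_N` of `x`. [cite: Colmez1998Annals, §III.2] -/
theorem evalₐ_frobBmaxPlus_iterate_of_eq (N : ℕ) {x : BmaxPlus F p} {y : bmaxZero F p}
    (hx : AdicCompletion.evalₐ (Ideal.span {(p : bmaxZero F p)}) N x = Ideal.Quotient.mk _ y) (n : ℕ) :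
    AdicCompletion.evalₐ (Ideal.span {(p : bmaxZero F p)}) N ((frobBmaxPlus F p)^[n] x) =
      Ideal.Quotient.mk _ ((frobBmaxZero F p)^[n] y) := by
  induction n with
  | zero => rwa [Function.iterate_zero, Function.iterate_zero]
  | succ n ih =>
    rw [Function.iterate_succ_apply', Function.iterate_succ_apply']
    exact evalₐ_frobBmaxPlus_of_eq N ih

set_option maxHeartbeats 1600000 in
omit [CharZero F] [IsAdicComplete (Ideal.span {(p : integerC F)}) (integerC F)] in
/-- ★ **`φⁿ(A_max) ⊆ 𝔸_inf + p^{n(p−1)}·A_max`, levelwise**: for every `x ∈ A_max` and `N ≤ n(p−1)`, `φⁿ(x) mod p^N` is the class of an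
element of `𝔸_inf`. [cite: Colmez1998Annals, §III.2] -/
theorem exists_evalₐ_frobBmaxPlus_iterate_eq_mk_algebraMap (x : BmaxPlus F p) {n N : ℕ} (hN : N ≤ n * (p - 1)) :
    ∃ a : Ainf (p := p) F, AdicCompletion.evalₐ (Ideal.span {(p : bmaxZero F p)}) N ((frobBmaxPlus F p)^[n] x) =
      Ideal.Quotient.mk _ (algebraMap (Ainf (p := p) F) (bmaxZero F p) a) := by
  obtain ⟨y, hy⟩ := Ideal.Quotient.mk_surjective (AdicCompletion.evalₐ (Ideal.span {(p : bmaxZero F p)}) N x)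
  obtain ⟨b, z, hbz⟩ := exists_frobBmaxZero_iterate_eq_algebraMap_add_pow_mul n y
  refine ⟨b, (evalₐ_frobBmaxPlus_iterate_of_eq N hy.symm n).trans ((Ideal.Quotient.eq).2 ?_)⟩
  rw [hbz, add_sub_cancel_left, Ideal.span_singleton_pow]
  exact Ideal.mul_mem_right _ _ (Ideal.span_singleton_le_span_singleton.2 (pow_dvd_pow _ hN) (Ideal.mem_span_singleton_self _))

/-! ### Eigenvectors: `pⁿ x ≡ ι(aₙ) (mod p^N)` -/

omit [CharZero F] [IsAdicComplete (Ideal.span {(p : integerC F)}) (integerC F)] in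
/-- For a `φ = p` eigenvector, `φⁿ(x) = pⁿ·x`. [folklore: iterate the eigen-relation] [cite: Colmez1998Annals, §III.3] -/
theorem frobBmaxPlus_iterate_eq_pow_mul {x : BmaxPlus F p} (hx : frobBmaxPlus F p x = (p : BmaxPlus F p) * x) (n : ℕ) :
    (frobBmaxPlus F p)^[n] x = (p : BmaxPlus F p) ^ n * x := by
  induction n with
  | zero => rw [Function.iterate_zero, id, pow_zero, one_mul]
  | succ n ih => rw [Function.iterate_succ_apply', ih, map_mul, map_pow, map_natCast, hx, pow_succ, mul_assoc]

set_option maxHeartbeats 1600000 in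
omit [CharZero F] [IsAdicComplete (Ideal.span {(p : integerC F)}) (integerC F)] in
/-- ★ **A `φ = p` eigenvector is `p`-adically a limit of `ι(aₙ)/pⁿ`**: if `φ(x) = p·x` in `A_max` then for all `N ≤ n(p−1)` there is
`aₙ ∈ 𝔸_inf` with `pⁿ·x ≡ ι(aₙ) (mod p^N A_max)` (so `x = lim ι(aₙ)/pⁿ` when `p ≥ 3`; e.g. `t = lim ([ε]^{pⁿ} − 1)/pⁿ`).
[cite: Colmez1998Annals, §III.3] -/
theorem exists_evalₐ_pow_mul_eq_mk_algebraMap_of_frobBmaxPlus_eq {x : BmaxPlus F p}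
    (hx : frobBmaxPlus F p x = (p : BmaxPlus F p) * x) {n N : ℕ} (hN : N ≤ n * (p - 1)) :
    ∃ a : Ainf (p := p) F, AdicCompletion.evalₐ (Ideal.span {(p : bmaxZero F p)}) N ((p : BmaxPlus F p) ^ n * x) =
      Ideal.Quotient.mk _ (algebraMap (Ainf (p := p) F) (bmaxZero F p) a) := by
  rw [← frobBmaxPlus_iterate_eq_pow_mul hx n]
  exact exists_evalₐ_frobBmaxPlus_iterate_eq_mk_algebraMap x hN

end Literature.NumberTheory.PAdicHodge

end
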